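import Mathlib

/-!
# Group-lemma core (case `p ∣ N`): unipotent generation of the image of `Γ₁(N)` in `SL(2, ℤ/mℤ)`

Blind cell `pub-manin-gamma0`, seat p3.  Paper reference: `proofs/GL_congruence_kernel_p3.md`, Theorem GL, Case A.

Let `m = N·p` with `p ∣ N`, so that `N² = 0` in `ℤ/mℤ`.  The image of `Γ₁(N)` in `SL(2, ℤ/mℤ)` consists of the matrices
`g = (1 + N a, b; N c, 1 + N d)` of determinant `1`.  We prove (`mem_closure_unipotent`) that every such `g` lies in the
subgroup generated by any three elements `T, V, U ∈ SL(2, ℤ/mℤ)` with matrices `(1 1; 0 1)`, `(1 0; N 1)`,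
`(1+N, N; -N, 1-N)` (such elements exist: `unipotent_generators_exist`), and (`unipotent_lifts_mem_Gamma1`) that the
integer matrices `(1 1; 0 1)`, `(1 0; N 1)`, `(1+N, N; -N, 1-N)` are elements of `Γ₁(N)` of trace `2`, i.e. unipotent.
Only Mathlib is imported; no definitions are introduced.
-/

namespace ManinGamma
namespace GLCore

open Matrix
open scoped MatrixGroups

/-- Entrywise criterion for equality of explicit `2 × 2` matrices. -/
theorem fin_two_eq {S : Type*} {a b c d a' b' c' d' : S} (h₁ : a = a') (h₂ : b = b') (h₃ : c = c')
    (h₄ : d = d') : !![a, b; c, d] = !![a', b'; c', d'] := by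
  subst h₁ h₂ h₃ h₄; rfl

/-- Powers of an element of `SL(2,R)` with matrix `(1 1; 0 1)`. -/
theorem coe_pow_of_eq_T {R : Type*} [CommRing R] (T : SL(2, R))
    (hT : (T : Matrix (Fin 2) (Fin 2) R) = !![1, 1; 0, 1]) (n : ℕ) :
    ((T ^ n : SL(2, R)) : Matrix (Fin 2) (Fin 2) R) = !![1, (n : R); 0, 1] := by
  induction n with
  | zero => simp [Matrix.one_fin_two]
  | succ k ih =>
    rw [pow_succ, Matrix.SpecialLinearGroup.coe_mul, ih, hT, Matrix.mul_fin_two]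
    push_cast
    exact fin_two_eq (by ring) (by ring) (by ring) (by ring)

/-- Powers of an element of `SL(2,R)` with matrix `(1 0; N 1)`. -/
theorem coe_pow_of_eq_V {R : Type*} [CommRing R] (N : R) (V : SL(2, R))
    (hV : (V : Matrix (Fin 2) (Fin 2) R) = !![1, 0; N, 1]) (n : ℕ) :
    ((V ^ n : SL(2, R)) : Matrix (Fin 2) (Fin 2) R) = !![1, 0; (n : R) * N, 1] := by
  induction n with
  | zero => simp [Matrix.one_fin_two]
  | succ k ih =>
    rw [pow_succ, Matrix.SpecialLinearGroup.coe_mul, ih, hV, Matrix.mul_fin_two]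
    push_cast
    exact fin_two_eq (by ring) (by ring) (by ring) (by ring)

/-- Powers of `E := U V` when `N² = 0`: `(U V)^n = (1 + nN, nN; 0, 1 - nN)`. -/
theorem coe_pow_UV {R : Type*} [CommRing R] (N : R) (hN : N * N = 0) (V U : SL(2, R))
    (hV : (V : Matrix (Fin 2) (Fin 2) R) = !![1, 0; N, 1])
    (hU : (U : Matrix (Fin 2) (Fin 2) R) = !![1 + N, N; -N, 1 - N]) (n : ℕ) :
    (((U * V) ^ n : SL(2, R)) : Matrix (Fin 2) (Fin 2) R) =
      !![1 + (n : R) * N, (n : R) * N; 0, 1 - (n : R) * N] := by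
  have hE : ((U * V : SL(2, R)) : Matrix (Fin 2) (Fin 2) R) = !![1 + N, N; 0, 1 - N] := by
    rw [Matrix.SpecialLinearGroup.coe_mul, hU, hV, Matrix.mul_fin_two]
    exact fin_two_eq (by linear_combination hN) (by ring) (by linear_combination (-1 : R) * hN) (by ring)
  induction n with
  | zero => simp [Matrix.one_fin_two]
  | succ k ih =>
    rw [pow_succ, Matrix.SpecialLinearGroup.coe_mul, ih, hE, Matrix.mul_fin_two]
    push_cast
    exact fin_two_eq (by linear_combination (k : R) * hN) (by ring) (by ring)
      (by linear_combination (k : R) * hN)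

/-- **GL core, case `p ∣ N`.**  Let `m ≥ 1` and `N ∈ ℤ/mℤ` with `N² = 0` (e.g. `m = N p` with `p ∣ N`), and let
`T, V, U ∈ SL(2, ℤ/mℤ)` have matrices `(1 1; 0 1)`, `(1 0; N 1)`, `(1+N, N; -N, 1-N)`.  Then every `g ∈ SL(2, ℤ/mℤ)`
of the form `(1 + N a, b; N c, 1 + N d)` lies in the subgroup generated by `T, V, U`; explicitly
`g = V^c · (U V)^a · T^β` with `β = b - aNb - aN`. -/
theorem mem_closure_unipotent {m : ℕ} [NeZero m] (N : ZMod m) (hN : N * N = 0) (T V U g : SL(2, ZMod m))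
    (hT : (T : Matrix (Fin 2) (Fin 2) (ZMod m)) = !![1, 1; 0, 1])
    (hV : (V : Matrix (Fin 2) (Fin 2) (ZMod m)) = !![1, 0; N, 1])
    (hU : (U : Matrix (Fin 2) (Fin 2) (ZMod m)) = !![1 + N, N; -N, 1 - N])
    (a b c d : ZMod m) (h₀₀ : (g : Matrix (Fin 2) (Fin 2) (ZMod m)) 0 0 = 1 + N * a)
    (h₀₁ : (g : Matrix (Fin 2) (Fin 2) (ZMod m)) 0 1 = b) (h₁₀ : (g : Matrix (Fin 2) (Fin 2) (ZMod m)) 1 0 = N * c)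
    (h₁₁ : (g : Matrix (Fin 2) (Fin 2) (ZMod m)) 1 1 = 1 + N * d) :
    g ∈ Subgroup.closure ({T, V, U} : Set SL(2, ZMod m)) := by
  have hdet : (1 + N * a) * (1 + N * d) - b * (N * c) = 1 := by
    have h := Matrix.SpecialLinearGroup.det_coe g
    rw [Matrix.det_fin_two, h₀₀, h₀₁, h₁₀, h₁₁] at h
    exact h
  set β : ZMod m := b - a * N * b - a * N with hβ
  have key : g = V ^ c.val * (U * V) ^ a.val * T ^ β.val := by
    apply Subtype.ext
    rw [Matrix.SpecialLinearGroup.coe_mul, Matrix.SpecialLinearGroup.coe_mul, coe_pow_of_eq_V N V hV,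
      coe_pow_UV N hN V U hV hU, coe_pow_of_eq_T T hT, ZMod.natCast_zmod_val, ZMod.natCast_zmod_val,
      ZMod.natCast_zmod_val, Matrix.mul_fin_two, Matrix.mul_fin_two,
      Matrix.eta_fin_two (g : Matrix (Fin 2) (Fin 2) (ZMod m)), h₀₀, h₀₁, h₁₀, h₁₁]
    refine fin_two_eq ?_ ?_ ?_ ?_
    · ring
    · rw [hβ]; linear_combination (a * a * (b + 1)) * hN
    · linear_combination (-(a * c)) * hN
    · rw [hβ]; linear_combination (a * a * c * (b + 1) * N - a * d) * hN + hdet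
  have hT' : T ∈ Subgroup.closure ({T, V, U} : Set SL(2, ZMod m)) := Subgroup.subset_closure (by simp)
  have hV' : V ∈ Subgroup.closure ({T, V, U} : Set SL(2, ZMod m)) := Subgroup.subset_closure (by simp)
  have hU' : U ∈ Subgroup.closure ({T, V, U} : Set SL(2, ZMod m)) := Subgroup.subset_closure (by simp)
  rw [key]
  exact Subgroup.mul_mem _ (Subgroup.mul_mem _ (Subgroup.pow_mem _ hV' _)
    (Subgroup.pow_mem _ (Subgroup.mul_mem _ hU' hV') _)) (Subgroup.pow_mem _ hT' _)

/-- The three unipotent generators exist in `SL(2, R)` for every commutative ring `R` and every `N ∈ R`. -/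
theorem unipotent_generators_exist {R : Type*} [CommRing R] (N : R) :
    ∃ T V U : SL(2, R), (T : Matrix (Fin 2) (Fin 2) R) = !![1, 1; 0, 1] ∧
      (V : Matrix (Fin 2) (Fin 2) R) = !![1, 0; N, 1] ∧ (U : Matrix (Fin 2) (Fin 2) R) = !![1 + N, N; -N, 1 - N] :=
  ⟨⟨!![1, 1; 0, 1], by simp [Matrix.det_fin_two_of]⟩, ⟨!![1, 0; N, 1], by simp [Matrix.det_fin_two_of]⟩,
    ⟨!![1 + N, N; -N, 1 - N], by rw [Matrix.det_fin_two_of]; ring⟩, rfl, rfl, rfl⟩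

/-- The generators are reductions of unipotent elements of `Γ₁(N)`: any `A ∈ SL(2,ℤ)` whose matrix is `(1 1; 0 1)`,
`(1 0; N 1)` or `(1+N, N; -N, 1-N)` belongs to `Γ₁(N)` and has trace `2`. -/
theorem unipotent_lifts_mem_Gamma1 (N : ℕ) (A : SL(2, ℤ))
    (hA : (A : Matrix (Fin 2) (Fin 2) ℤ) = !![1, 1; 0, 1] ∨ (A : Matrix (Fin 2) (Fin 2) ℤ) = !![1, 0; (N : ℤ), 1] ∨
      (A : Matrix (Fin 2) (Fin 2) ℤ) = !![1 + (N : ℤ), (N : ℤ); -(N : ℤ), 1 - (N : ℤ)]) :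
    A ∈ CongruenceSubgroup.Gamma1 N ∧ (A : Matrix (Fin 2) (Fin 2) ℤ).trace = 2 := by
  rcases hA with h | h | h
  · refine ⟨(CongruenceSubgroup.Gamma1_mem N A).mpr ?_, ?_⟩
    · simp [h]
    · rw [h, Matrix.trace_fin_two]; simp
  · refine ⟨(CongruenceSubgroup.Gamma1_mem N A).mpr ?_, ?_⟩
    · simp [h]
    · rw [h, Matrix.trace_fin_two]; simp
  · refine ⟨(CongruenceSubgroup.Gamma1_mem N A).mpr ?_, ?_⟩
    · simp [h]
    · rw [h, Matrix.trace_fin_two]; simp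

end GLCore
end ManinGamma
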